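import Mathlib

/-!
# The algebraic core of the class-O certificate (blind cell PercRepro2, night-1 g8; NIGHT1-G8.md §1)

`a₃` adjacent only to `a₁` (coin `α`), `a₂` (coin `β`) and `o` (coin `r`).  With the `G₁`-table
(`Z₁ = P(Q₁)`, `A_x = P(Q₁, o ∈ x)`, `P_xy = P(Q₁, o ∈ x, b ∈ y)`, `c_ob`, the pendant-root
functionals `G_ob`, `G′_ob`, `X₀ = (A_L B_H + A_H B_L)/Z₁`) every mass of `HMFc` is the explicit
multi-affine expression below (`zMass`, `dMass`, …; NIGHT1-G8.md §1, twinned mass by mass against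
the brute-force evaluator), and

  `Z₁ · HMFc = 2(1−α)(1−β)(1−r) · K(α, β, r)`,   `K = Σ κ_{ijk} α^i(1−α)^{2−i} β^j(1−β)^{2−j} r^k(1−r)^{2−k}`

with every `κ_{ijk}` a nonnegative combination of the slacks `s_LH, s_HL` (cross-cluster BHK),
`u_LL, u_HH` (functional same-cluster BHK), `h_LL, h_HH` (Harris in the residual rows), `c_ob` and
nonnegative mass polynomials.  This file checks that algebra in the kernel: `classO_identity`
(the identity, a polynomial identity modulo `Z₁ X₀ = A_L B_H + A_H B_L`) and `classO_K_nonneg`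
(`K ≥ 0` from the slack signs).  The probabilistic content — that the masses of an actual
class-O instance are these expressions and that the slacks are `≥ 0` (`bhk_cross_heavy`,
`bhk_same_heavy`, Harris) — is the remaining typer-sized step; NIGHT1-G8.md §4 is its spec.
-/

namespace Summit.Ventures.PercRepro2

namespace StarO

variable {R : Type*} [CommRing R]

/-! ## The masses of the class-O instance in the `G₁`-table (`x̄ = 1 − x`) -/

/-- `P(Q) = ᾱβ̄Z₁ + αβ̄(Z₁ − rA_H) + βᾱ(Z₁ − rA_L)`. -/
def zMass (Z1 AL AH al be r : R) : R :=
  (1 - al) * (1 - be) * Z1 + al * (1 - be) * (Z1 - r * AH) + be * (1 - al) * (Z1 - r * AL)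

/-- `D = P(PD) = ᾱβ̄(r̄Z₁ + rA_N)`, `A_N = Z₁ − A_L − A_H`. -/
def dMass (Z1 AL AH al be r : R) : R :=
  (1 - al) * (1 - be) * ((1 - r) * Z1 + r * (Z1 - AL - AH))

/-- `D_o = P(PD, o ∈ U) = ᾱβ̄r̄(A_L + A_H)`. -/
def doMass (AL AH al be r : R) : R := (1 - al) * (1 - be) * (1 - r) * (AL + AH)

/-- `W = M₂ + Δ_T`. -/
def wMass (BL BH PLH PLL PHL PHH PNH cob al be r : R) : R :=
  (1 - al) * (1 - be) * ((1 - r) * BH + r * PNH) +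
    ((1 - al) * (be * (BH - r * PLH + r * cob) + (1 - be) * r * PHH) -
      (1 - al) * (be * (BL - r * PLL) + (1 - be) * r * PHL))

/-- `E_Q[σ₃] = P(T′) − P(T)`. -/
def eq3Mass (Z1 AL AH al be r : R) : R :=
  (1 - be) * (al * (Z1 - r * AH) + (1 - al) * r * AL) -
    (1 - al) * (be * (Z1 - r * AL) + (1 - be) * r * AH)

/-- `E_Q[σ₃ 1_{o∈U}] = P(T′, oU) − P(T, oU)`. -/
def eq3oMass (Z1 AL AH al be r : R) : R :=
  (1 - be) * (al * (AL + (1 - r) * AH + r * (Z1 - AL - AH)) + (1 - al) * r * AL) -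
    (1 - al) * (be * (AH + (1 - r) * AL + r * (Z1 - AL - AH)) + (1 - be) * r * AH)

/-- `E_Q[σ_o] = P(Q, oL) − P(Q, oH)`. -/
def eqoMass (Z1 AL AH al be r : R) : R :=
  (al * (1 - be) * (AL + r * (Z1 - AL - AH)) + (1 - al) * AL * (1 - be * r)) -
    (be * (1 - al) * (AH + r * (Z1 - AL - AH)) + (1 - be) * AH * (1 - al * r))

/-- `gap = P(Q, bH) − P(Q, bL)`. -/
def gapMass (BL BH PLH PLL PHL PHH cob al be r : R) : R :=
  ((1 - al) * (1 - be) * BH + al * (1 - be) * (BH - r * PHH) +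
      be * (1 - al) * (BH - r * PLH + r * cob)) -
    ((1 - al) * (1 - be) * BL + be * (1 - al) * (BL - r * PLL) +
      al * (1 - be) * (BL - r * PHL + r * cob))

/-- `X̂ = r̄[ᾱβ̄X₀ + βᾱ(P_LH − G_ob) + αβ̄(P_HL − G′_ob)]`. -/
def xhatMass (PLH PHL Gob Gpob X0 al be r : R) : R :=
  (1 - r) * ((1 - al) * (1 - be) * X0 + be * (1 - al) * (PLH - Gob) + al * (1 - be) * (PHL - Gpob))

/-- `HMFc = 2 P(Q) (D_o W − X̂ D) − gap · (D_o P(Q) − (D E_Q[σ_o] + D_o E_Q[σ₃] − D E_Q[σ₃ 1_{o∈U}]))`. -/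
def hmfcMass (Z1 AL AH BL BH PLH PLL PHL PHH PNH cob Gob Gpob X0 al be r : R) : R :=
  2 * zMass Z1 AL AH al be r *
      (doMass AL AH al be r * wMass BL BH PLH PLL PHL PHH PNH cob al be r -
        xhatMass PLH PHL Gob Gpob X0 al be r * dMass Z1 AL AH al be r) -
    gapMass BL BH PLH PLL PHL PHH cob al be r *
      (doMass AL AH al be r * zMass Z1 AL AH al be r -
        (dMass Z1 AL AH al be r * eqoMass Z1 AL AH al be r +
          doMass AL AH al be r * eq3Mass Z1 AL AH al be r -
          dMass Z1 AL AH al be r * eq3oMass Z1 AL AH al be r))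

/-! ## The certificate `K` in the slack vocabulary -/

/-- `K(α, β, r)` in the atom vocabulary: `Z1, AL, AH, AN = Z₁ − A_L − A_H, cob ≥ 0`, the slacks
`sLH, sHL, uLL, uHH, hLL, hHH ≥ 0`, `Θ_h = sLH + uLL`, `Θ_l = sHL + uHH`.  The seventeen
coefficients are those of NIGHT1-G8.md §1. -/
def Kcert (Z1 AL AH cob sLH sHL uLL uHH hLL hHH al be r : R) : R :=
  let AN := Z1 - AL - AH
  let Th := sLH + uLL
  let Tl := sHL + uHH
  -- (i, j, k): α^i(1−α)^{2−i} β^j(1−β)^{2−j} r^k(1−r)^{2−k}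
  (Z1 * (AL + AH) * (sLH + sHL)) * ((1 - al)^2 * (1 - be)^2 * (r * (1 - r) + r^2)) +
  (Z1 * Z1 * Th) * ((1 - al)^2 * (be * (1 - be) + be^2) * (1 - r)^2) +
  (Z1 * Z1 * Tl) * ((al * (1 - al) + al^2) * (1 - be)^2 * (1 - r)^2) +
  (Z1 * Z1 * (Th + Tl)) * (al * (1 - al) * be * (1 - be) * (1 - r)^2) +
  (Z1 * (Z1 + AN) * Th + Z1 * Z1 * AL * (hLL + cob)) * ((1 - al)^2 * be^2 * r * (1 - r)) +
  (Z1 * AN * (Th + AL * (hLL + cob))) * ((1 - al)^2 * be^2 * r^2) +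
  (Z1 * (Z1 + AN) * Tl + Z1 * Z1 * AH * (hHH + cob)) * (al^2 * (1 - be)^2 * r * (1 - r)) +
  (Z1 * AN * (Tl + AH * (hHH + cob))) * (al^2 * (1 - be)^2 * r^2) +
  (2 * Z1 * Z1 * sLH + Z1 * (2 * Z1 - AH) * uLL + Z1 * (AL + AH) * sHL + Z1 * AL * sLH +
      Z1 * Z1 * AL * (hLL + cob)) * ((1 - al)^2 * be * (1 - be) * r * (1 - r)) +
  (Z1 * Z1 * sLH + Z1 * (Z1 - AH) * uLL + AL * AN * sLH + (Z1 - AL) * (AL + AH) * sHL +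
      Z1 * Z1 * AL * (hLL + cob)) * ((1 - al)^2 * be * (1 - be) * r^2) +
  (2 * Z1 * Z1 * sHL + Z1 * (2 * Z1 - AL) * uHH + Z1 * (AL + AH) * sLH + Z1 * AH * sHL +
      Z1 * Z1 * AH * (hHH + cob)) * (al * (1 - al) * (1 - be)^2 * r * (1 - r)) +
  (Z1 * Z1 * sHL + Z1 * (Z1 - AL) * uHH + AH * AN * sHL + (Z1 - AH) * (AL + AH) * sLH +
      Z1 * Z1 * AH * (hHH + cob)) * (al * (1 - al) * (1 - be)^2 * r^2) +
  (2 * Z1 * (Z1 - AH) * Th + 2 * Z1 * (Z1 - AL) * Tl +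
      Z1 * Z1 * (AL * (hLL + cob) + AH * (hHH + cob))) * (al * (1 - al) * be * (1 - be) * r * (1 - r)) +
  (((Z1 - AH) * (Z1 - AH) + AL * AH) * Th + ((Z1 - AL) * (Z1 - AL) + AL * AH) * Tl +
      Z1 * Z1 * (AL * (hLL + cob) + AH * (hHH + cob))) * (al * (1 - al) * be * (1 - be) * r^2)

/-- **The class-O identity** (NIGHT1-G8.md §1): with `B_y = Σ_x P_xy`, `Z₁X₀ = A_LB_H + A_HB_L` and the
slacks written out, `Z₁ · HMFc = 2(1−α)(1−β)(1−r) · K`. -/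
theorem classO_identity (Z1 AL AH PLH PLL PHL PHH PNH PNL cob Gob Gpob X0 al be r : R)
    (hX0 : Z1 * X0 = AL * (PLH + PHH + PNH) + AH * (PLL + PHL + PNL)) :
    Z1 * hmfcMass Z1 AL AH (PLL + PHL + PNL) (PLH + PHH + PNH) PLH PLL PHL PHH PNH cob Gob Gpob X0
        al be r =
      2 * (1 - al) * (1 - be) * (1 - r) *
        Kcert Z1 AL AH cob (AL * (PLH + PHH + PNH) - Z1 * PLH) (AH * (PLL + PHL + PNL) - Z1 * PHL)
          (Z1 * Gob - AL * (PLL + PHL + PNL)) (Z1 * Gpob - AH * (PLH + PHH + PNH)) (PLL - Gob)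
          (PHH - Gpob) al be r := by
  unfold hmfcMass zMass dMass doMass wMass eq3Mass eq3oMass eqoMass gapMass xhatMass Kcert
  linear_combination (-2 * (1 - r) * (1 - al) * (1 - be) *
    ((1 - al) * (1 - be) * Z1 + al * (1 - be) * (Z1 - r * AH) + be * (1 - al) * (Z1 - r * AL)) *
    ((1 - al) * (1 - be) * ((1 - r) * Z1 + r * (Z1 - AL - AH)))) * hX0

/-! ## The sign of `K` -/

/-- `K` written on nonnegative atoms only: `AN = Z₁ − A_L − A_H`, `ZmAL = Z₁ − A_L`, `ZmAH = Z₁ − A_H`,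
`Z2mAL = 2Z₁ − A_L`, `Z2mAH = 2Z₁ − A_H`, `alb = 1 − α`, `beb = 1 − β`, `rb = 1 − r`. -/
def Kpos (Z1 AL AH AN ZmAL ZmAH Z2mAL Z2mAH cob sLH sHL uLL uHH hLL hHH al alb be beb r rb : R) :
    R :=
  let Th := sLH + uLL
  let Tl := sHL + uHH
  (Z1 * (AL + AH) * (sLH + sHL)) * (alb^2 * beb^2 * (r * rb + r^2)) +
  (Z1 * Z1 * Th) * (alb^2 * (be * beb + be^2) * rb^2) +
  (Z1 * Z1 * Tl) * ((al * alb + al^2) * beb^2 * rb^2) +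
  (Z1 * Z1 * (Th + Tl)) * (al * alb * be * beb * rb^2) +
  (Z1 * (Z1 + AN) * Th + Z1 * Z1 * AL * (hLL + cob)) * (alb^2 * be^2 * r * rb) +
  (Z1 * AN * (Th + AL * (hLL + cob))) * (alb^2 * be^2 * r^2) +
  (Z1 * (Z1 + AN) * Tl + Z1 * Z1 * AH * (hHH + cob)) * (al^2 * beb^2 * r * rb) +
  (Z1 * AN * (Tl + AH * (hHH + cob))) * (al^2 * beb^2 * r^2) +
  (2 * Z1 * Z1 * sLH + Z1 * Z2mAH * uLL + Z1 * (AL + AH) * sHL + Z1 * AL * sLH +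
      Z1 * Z1 * AL * (hLL + cob)) * (alb^2 * be * beb * r * rb) +
  (Z1 * Z1 * sLH + Z1 * ZmAH * uLL + AL * AN * sLH + ZmAL * (AL + AH) * sHL +
      Z1 * Z1 * AL * (hLL + cob)) * (alb^2 * be * beb * r^2) +
  (2 * Z1 * Z1 * sHL + Z1 * Z2mAL * uHH + Z1 * (AL + AH) * sLH + Z1 * AH * sHL +
      Z1 * Z1 * AH * (hHH + cob)) * (al * alb * beb^2 * r * rb) +
  (Z1 * Z1 * sHL + Z1 * ZmAL * uHH + AH * AN * sHL + ZmAH * (AL + AH) * sLH +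
      Z1 * Z1 * AH * (hHH + cob)) * (al * alb * beb^2 * r^2) +
  (2 * Z1 * ZmAH * Th + 2 * Z1 * ZmAL * Tl +
      Z1 * Z1 * (AL * (hLL + cob) + AH * (hHH + cob))) * (al * alb * be * beb * r * rb) +
  ((ZmAH * ZmAH + AL * AH) * Th + (ZmAL * ZmAL + AL * AH) * Tl +
      Z1 * Z1 * (AL * (hLL + cob) + AH * (hHH + cob))) * (al * alb * be * beb * r^2)

/-- `Kcert` is `Kpos` on the atoms. -/
lemma Kcert_eq_Kpos (Z1 AL AH cob sLH sHL uLL uHH hLL hHH al be r : R) :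
    Kcert Z1 AL AH cob sLH sHL uLL uHH hLL hHH al be r =
      Kpos Z1 AL AH (Z1 - AL - AH) (Z1 - AL) (Z1 - AH) (2 * Z1 - AL) (2 * Z1 - AH) cob sLH sHL uLL
        uHH hLL hHH al (1 - al) be (1 - be) r (1 - r) := by
  unfold Kcert Kpos
  ring

end StarO

namespace StarO

variable {R : Type*} [CommRing R] [LinearOrder R] [IsStrictOrderedRing R]

/-- `Kpos ≥ 0` on nonnegative atoms. -/
lemma Kpos_nonneg {Z1 AL AH AN ZmAL ZmAH Z2mAL Z2mAH cob sLH sHL uLL uHH hLL hHH al alb be beb r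
    rb : R} (h1 : 0 ≤ Z1) (h2 : 0 ≤ AL) (h3 : 0 ≤ AH) (h4 : 0 ≤ AN) (h5 : 0 ≤ ZmAL) (h6 : 0 ≤ ZmAH)
    (h7 : 0 ≤ Z2mAL) (h8 : 0 ≤ Z2mAH) (h9 : 0 ≤ cob) (h10 : 0 ≤ sLH) (h11 : 0 ≤ sHL) (h12 : 0 ≤ uLL)
    (h13 : 0 ≤ uHH) (h14 : 0 ≤ hLL) (h15 : 0 ≤ hHH) (h16 : 0 ≤ al) (h17 : 0 ≤ alb) (h18 : 0 ≤ be)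
    (h19 : 0 ≤ beb) (h20 : 0 ≤ r) (h21 : 0 ≤ rb) :
    0 ≤ Kpos Z1 AL AH AN ZmAL ZmAH Z2mAL Z2mAH cob sLH sHL uLL uHH hLL hHH al alb be beb r rb := by
  unfold Kpos
  positivity

/-- **`K ≥ 0`** for coins in `[0, 1]`, nonnegative masses with `A_L + A_H ≤ Z₁`, and nonnegative
slacks. -/
theorem classO_K_nonneg {Z1 AL AH cob sLH sHL uLL uHH hLL hHH al be r : R} (hZ : 0 ≤ Z1)
    (hAL : 0 ≤ AL) (hAH : 0 ≤ AH) (hAN : AL + AH ≤ Z1) (hcob : 0 ≤ cob) (hsLH : 0 ≤ sLH)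
    (hsHL : 0 ≤ sHL) (huLL : 0 ≤ uLL) (huHH : 0 ≤ uHH) (hhLL : 0 ≤ hLL) (hhHH : 0 ≤ hHH)
    (hal : 0 ≤ al) (hal' : al ≤ 1) (hbe : 0 ≤ be) (hbe' : be ≤ 1) (hr : 0 ≤ r) (hr' : r ≤ 1) :
    0 ≤ Kcert Z1 AL AH cob sLH sHL uLL uHH hLL hHH al be r := by
  rw [Kcert_eq_Kpos]
  exact Kpos_nonneg hZ hAL hAH (by linarith) (by linarith) (by linarith) (by linarith) (by linarith)
    hcob hsLH hsHL huLL huHH hhLL hhHH hal (by linarith) hbe (by linarith) hr (by linarith)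

/-- **The class-O theorem, algebraic form**: `0 ≤ Z₁ · HMFc` whenever the masses are the class-O
expressions, the coins lie in `[0, 1]` and the six slacks are nonnegative. -/
theorem classO_hmfc_nonneg {Z1 AL AH PLH PLL PHL PHH PNH PNL cob Gob Gpob X0 al be r : R}
    (hX0 : Z1 * X0 = AL * (PLH + PHH + PNH) + AH * (PLL + PHL + PNL)) (hZ : 0 ≤ Z1) (hAL : 0 ≤ AL)
    (hAH : 0 ≤ AH) (hAN : AL + AH ≤ Z1) (hcob : 0 ≤ cob)
    (hsLH : 0 ≤ AL * (PLH + PHH + PNH) - Z1 * PLH) (hsHL : 0 ≤ AH * (PLL + PHL + PNL) - Z1 * PHL)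
    (huLL : 0 ≤ Z1 * Gob - AL * (PLL + PHL + PNL)) (huHH : 0 ≤ Z1 * Gpob - AH * (PLH + PHH + PNH))
    (hhLL : 0 ≤ PLL - Gob) (hhHH : 0 ≤ PHH - Gpob) (hal : 0 ≤ al) (hal' : al ≤ 1) (hbe : 0 ≤ be)
    (hbe' : be ≤ 1) (hr : 0 ≤ r) (hr' : r ≤ 1) :
    0 ≤ Z1 * hmfcMass Z1 AL AH (PLL + PHL + PNL) (PLH + PHH + PNH) PLH PLL PHL PHH PNH cob Gob Gpob
      X0 al be r := by
  rw [classO_identity Z1 AL AH PLH PLL PHL PHH PNH PNL cob Gob Gpob X0 al be r hX0]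
  have hK := classO_K_nonneg hZ hAL hAH hAN hcob hsLH hsHL huLL huHH hhLL hhHH hal hal' hbe hbe' hr hr'
  have h1 : 0 ≤ 1 - al := by linarith
  have h2 : 0 ≤ 1 - be := by linarith
  have h3 : 0 ≤ 1 - r := by linarith
  positivity

end StarO

end Summit.Ventures.PercRepro2
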